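import Summits.AnomalousDissipation.AnomalousDissipation.Theorems.SolenoidalFractalHomogenisationLagrangianStepOneLevelSplitDefsH
import Summits.AnomalousDissipation.AnomalousDissipation.Theorems.IsotropicCubatureWord

/-!
# W7 `HighLabelDecayW` — the typed THREE-PIECE RE-CUT (planner ad-ideate-p5 g9, lens «profile»)

Skeleton for `stub_highLabelDecay_IS` (`Lines/onelevel_highLabelDecay.lean`): the flat W7 clause for `cubatureWord` follows,
by the kernel-checked composition `highLabelDecay_IS_of_recut` below, from three named pieces —

* `stub_classReduction`  (M) — PER-BLOCH-CLASS REDUCTION: it suffices to treat data living on ONE class `ℓ + nℤ³` at distance `≥ L`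
  from the lattice (class support is preserved by the cell evolution — `PassiveVectorTensorUniqueness` + Galerkin — and energy is
  additive over classes, so the SAME `CK, cK` pass through);
* `stub_compactRange`    (L) — classes with `dist ≤ R₁·nν` (label ratio `r ∈ [1/Kb, R₁]`): continuity of the slot maps in `(r, κ, 𝔸/ν)`
  incl. the `ν → 0` limit on the slow lines + compactness + the LOSSLESS ANALYSIS (`HighLabelDecayCoverage.no_slotTerm_null`): no rate
  is computed, only `inf (1 − φ²) > 0`; NO homogenisation / hypocoercivity needed here (profile: `σ_period = e^{−0.709 M r²}` to 4 digits
  for r ≤ 2, job j316375);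
* `stub_largeR`          (XL) — classes with `dist ≥ R₁·nν` for ONE `R₁`: uniform relaxation enhancement of the coupled-unshielded slot
  that `HighLabelDecayCoverage.coupledUnshielded_exists` provides for every fibre direction (engine: Bedrossian–Coti Zelati 2017
  Thm 1.1, arXiv:1510.08098 p.3, `ν/|k| ≤ κ₀` ⇔ `r_s ≥ R₁`, rate `ν^{1/2}|k|^{1/2}/log²`; to be adapted to the Bloch chain with triangle
  envelope, two polarisation chains (centre links weakened by `|m̂·q̂| ≥ γ₀·…`) and the `𝔸`-window; profile: single-slot norm `7e-7` at
  `r_s = 100`, job j316375),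

and the elementary splice `classDecayW_split` (case split on the class distance, constants `max CK`, `min cK`, `min ν₀`).
`sorry` only inside the three `stub_*`.
-/

namespace Summit.AnomalousDissipation.AnomalousDissipation.Cruxes.LagrangianRenormalisationStepDesign.HighLabelDecayRecut

open Literature.Analysis Literature.Analysis.FluidPDE Literature.Analysis.FunctionSpaces
open MeasureTheory Set
open scoped InnerProductSpace
open Summit.AnomalousDissipation.AnomalousDissipation.Theorems
open Summit.AnomalousDissipation.AnomalousDissipation.Theorems.SolenoidalFractalHomogenisation.LagrangianStep

noncomputable section

/-- PER-CLASS high-label decay with an admissibility predicate `adm n ν ℓ` on the Bloch class `ℓ + nℤ³` (all classes: `admAll`;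
near classes `dist ≤ R₁ n ν`: `admCompact R₁`; far classes: `admLarge R₁`).  Same binders and conclusion as `HighLabelDecayW`, the support
hypothesis being: `F` has modes only on the class of `ℓ`, and the class stays at distance `≥ L` from the lattice `nℤ³`. -/
def ClassDecayW {k : ℕ} (W : LatticeShear.LatticeWord k) (M : ℝ) (hM : 0 < M) (lo hi Λ β ν₀ Kb CK cK : ℝ)
    (adm : ℕ → ℝ → (Fin 3 → ℤ) → Prop) : Prop :=
  ∀ ν, ∀ hν : ν ∈ Set.Ioo 0 ν₀, ∀ n : ℕ, 1 ≤ n → ∀ 𝔸 : Torus.Visc4 (Fin 3),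
    Torus.OddSmall 𝔸 (ν * β) → (∃ lam ∈ Set.Icc (1:ℝ) Λ, Torus.NearIso 𝔸 (ν * (lo / lam)) (ν * (hi * lam))) →
    ∀ L > (0:ℝ), (n : ℝ) * ν ≤ Kb * L →
    ∀ ℓ : Fin 3 → ℤ, (∀ z : Fin 3 → ℤ, L ≤ ‖Torus.latticeVec (ℓ + (n : ℤ) • z)‖) → adm n ν ℓ →
    ∀ F : VF, IsDatum F →
      (∀ k' : Fin 3 → ℤ, (¬ ∃ z : Fin 3 → ℤ, k' = ℓ + (n : ℤ) • z) → ∀ i, modeCoeff k' F i = 0) →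
      ∀ T > (0:ℝ), ∀ u : ℝ → VF,
        Torus.IsWeakTensorPassiveVectorOn 0 T ((1 / (n:ℝ) ^ 2) • 𝔸) (cellField W M hM ν hν.1 n) F u →
        ∀ᵐ t ∂(volume.restrict (Ioo 0 T)),
          ∫ x, ‖u t x‖ ^ 2 ≤ CK * Real.exp (-(2 * cK * ν * t)) * ∫ x, ‖F x‖ ^ 2

/-- All classes. -/
def admAll : ℕ → ℝ → (Fin 3 → ℤ) → Prop := fun _ _ _ => True
/-- Near classes: label ratio `r = dist/(nν) ≤ R₁`. -/
def admCompact (R₁ : ℝ) : ℕ → ℝ → (Fin 3 → ℤ) → Prop :=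
  fun n ν ℓ => ∃ z : Fin 3 → ℤ, ‖Torus.latticeVec (ℓ + (n : ℤ) • z)‖ ≤ R₁ * n * ν
/-- Far classes: `r ≥ R₁`. -/
def admLarge (R₁ : ℝ) : ℕ → ℝ → (Fin 3 → ℤ) → Prop :=
  fun n ν ℓ => ∀ z : Fin 3 → ℤ, R₁ * n * ν ≤ ‖Torus.latticeVec (ℓ + (n : ℤ) • z)‖

/-- Pointwise weakening of the decay profile: larger prefactor, smaller rate. -/
theorem profile_mono {CK CK' cK cK' ν t X : ℝ} (hCK : CK ≤ CK') (hcK : cK' ≤ cK) (hCK0 : 0 ≤ CK') (hν : 0 ≤ ν) (ht : 0 ≤ t)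
    (hX : 0 ≤ X) : CK * Real.exp (-(2 * cK * ν * t)) * X ≤ CK' * Real.exp (-(2 * cK' * ν * t)) * X := by
  have h1 : Real.exp (-(2 * cK * ν * t)) ≤ Real.exp (-(2 * cK' * ν * t)) := by
    apply Real.exp_le_exp.mpr
    have : cK' * (ν * t) ≤ cK * (ν * t) := mul_le_mul_of_nonneg_right hcK (mul_nonneg hν ht)
    nlinarith
  have h2 : CK * Real.exp (-(2 * cK * ν * t)) ≤ CK' * Real.exp (-(2 * cK' * ν * t)) :=
    calc CK * Real.exp (-(2 * cK * ν * t)) ≤ CK' * Real.exp (-(2 * cK * ν * t)) :=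
          mul_le_mul_of_nonneg_right hCK (Real.exp_pos _).le
      _ ≤ CK' * Real.exp (-(2 * cK' * ν * t)) := mul_le_mul_of_nonneg_left h1 hCK0
  exact mul_le_mul_of_nonneg_right h2 hX

/-- Monotonicity of `ClassDecayW` in `(CK, cK, ν₀)` and in the admissibility predicate. -/
theorem classDecayW_mono {k : ℕ} {W : LatticeShear.LatticeWord k} {M : ℝ} {hM : 0 < M} {lo hi Λ β ν₀ ν₀' Kb CK CK' cK cK' : ℝ}
    {adm adm' : ℕ → ℝ → (Fin 3 → ℤ) → Prop} (hν₀ : ν₀' ≤ ν₀) (hCK : CK ≤ CK') (hcK : cK' ≤ cK) (hCK0 : 0 ≤ CK')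
    (hadm : ∀ n ν ℓ, adm' n ν ℓ → adm n ν ℓ) (h : ClassDecayW W M hM lo hi Λ β ν₀ Kb CK cK adm) :
    ClassDecayW W M hM lo hi Λ β ν₀' Kb CK' cK' adm' := by
  intro ν hν n hn 𝔸 hodd hwin L hL hKL ℓ hdist hadm' F hF hsupp T hT u hu
  have hν' : ν ∈ Set.Ioo 0 ν₀ := ⟨hν.1, lt_of_lt_of_le hν.2 hν₀⟩
  have hX : 0 ≤ ∫ x, ‖F x‖ ^ 2 := integral_nonneg fun x => by positivity
  filter_upwards [h ν hν' n hn 𝔸 hodd hwin L hL hKL ℓ hdist (hadm n ν ℓ hadm') F hF hsupp T hT u hu,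
    ae_restrict_mem measurableSet_Ioo] with t ht htI
  exact ht.trans (profile_mono hCK hcK hCK0 hν.1.le htI.1.le hX)

/-- SPLICE: near classes + far classes (same `R₁`) give all classes, with constants `max CK`, `min cK`, `min ν₀`. -/
theorem classDecayW_split {k : ℕ} {W : LatticeShear.LatticeWord k} {M : ℝ} {hM : 0 < M} {lo hi Λ β ν₁ ν₂ Kb CK₁ CK₂ cK₁ cK₂ : ℝ}
    (R₁ : ℝ) (hCK₁ : 0 ≤ CK₁)
    (h₁ : ClassDecayW W M hM lo hi Λ β ν₁ Kb CK₁ cK₁ (admCompact R₁))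
    (h₂ : ClassDecayW W M hM lo hi Λ β ν₂ Kb CK₂ cK₂ (admLarge R₁)) :
    ClassDecayW W M hM lo hi Λ β (min ν₁ ν₂) Kb (max CK₁ CK₂) (min cK₁ cK₂) admAll := by
  intro ν hν n hn 𝔸 hodd hwin L hL hKL ℓ hdist _ F hF hsupp T hT u hu
  have hCK0 : 0 ≤ max CK₁ CK₂ := le_max_of_le_left hCK₁
  by_cases hc : ∃ z : Fin 3 → ℤ, ‖Torus.latticeVec (ℓ + (n : ℤ) • z)‖ ≤ R₁ * n * ν
  · have h₁' := classDecayW_mono (adm' := admCompact R₁) (min_le_left ν₁ ν₂) (le_max_left CK₁ CK₂) (min_le_left cK₁ cK₂) hCK0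
      (fun _ _ _ h => h) h₁
    exact h₁' ν hν n hn 𝔸 hodd hwin L hL hKL ℓ hdist hc F hF hsupp T hT u hu
  · have hfar : admLarge R₁ n ν ℓ := by
      intro z
      by_contra hz
      exact hc ⟨z, (not_le.mp hz).le⟩
    have h₂' := classDecayW_mono (adm' := admLarge R₁) (min_le_right ν₁ ν₂) (le_max_right CK₁ CK₂) (min_le_right cK₁ cK₂) hCK0
      (fun _ _ _ h => h) h₂
    exact h₂' ν hν n hn 𝔸 hodd hwin L hL hKL ℓ hdist hfar F hF hsupp T hT u hu

/-- PIECE 1 (M) — PER-CLASS REDUCTION: class support is invariant under the cell evolution and energy adds over classes, so the all-class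
statement gives the flat clause with the same constants. [engine: `PassiveVectorTensorUniqueness` + Fourier class projection; W7 brief
"bookkeeping" item; not proved here] -/
theorem stub_classReduction {k : ℕ} (W : LatticeShear.LatticeWord k) (M : ℝ) (hM : 0 < M) (lo hi Λ β ν₀ Kb CK cK : ℝ) :
    ClassDecayW W M hM lo hi Λ β ν₀ Kb CK cK admAll → HighLabelDecayW W M hM lo hi Λ β ν₀ Kb CK cK := by
  sorry

/-- PIECE 2 (L) — COMPACT LABEL RANGE `r ∈ [1/Kb, R₁]`, every `R₁`: continuity + compactness + lossless analysis
(`HighLabelDecayCoverage.no_slotTerm_null`); no rate computed. [not proved here] -/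
theorem stub_compactRange (M : ℝ) (hM : 0 < M) (lo hi Λ β : ℝ) (hlo : 0 < lo) (hlo1 : lo ≤ 1) (hhi : 1 ≤ hi) (hΛ : 1 < Λ)
    (hβ : 0 ≤ β) (Kb : ℝ) (hKb : 1 ≤ Kb) (R₁ : ℝ) (hR₁ : 1 ≤ R₁) :
    ∃ CK : ℝ, 1 ≤ CK ∧ ∃ cK > (0:ℝ), ∃ ν₀ > (0:ℝ), ClassDecayW cubatureWord M hM lo hi Λ β ν₀ Kb CK cK (admCompact R₁) := by
  sorry

/-- PIECE 3 (XL) — LARGE LABEL RATIO `r ≥ R₁` for ONE `R₁`: uniform relaxation enhancement of the coupled-unshielded slot of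
`HighLabelDecayCoverage.coupledUnshielded_exists` (Bedrossian–Coti Zelati 2017 Thm 1.1 engine, arXiv:1510.08098). [not proved here] -/
theorem stub_largeR (M : ℝ) (hM : 0 < M) (lo hi Λ β : ℝ) (hlo : 0 < lo) (hlo1 : lo ≤ 1) (hhi : 1 ≤ hi) (hΛ : 1 < Λ)
    (hβ : 0 ≤ β) (Kb : ℝ) (hKb : 1 ≤ Kb) :
    ∃ R₁ : ℝ, 1 ≤ R₁ ∧ ∃ CK : ℝ, 1 ≤ CK ∧ ∃ cK > (0:ℝ), ∃ ν₀ > (0:ℝ),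
      ClassDecayW cubatureWord M hM lo hi Λ β ν₀ Kb CK cK (admLarge R₁) := by
  sorry

/-- COMPOSITION (kernel-checked): the three pieces give the text of `stub_highLabelDecay_IS` verbatim. -/
theorem highLabelDecay_IS_of_recut : ∀ (M : ℝ) (hM : 0 < M) (lo hi Λ β : ℝ), 0 < lo → lo ≤ 1 → 1 ≤ hi → 1 < Λ → 0 ≤ β →
    ∀ Kb : ℝ, 1 ≤ Kb → ∃ CK : ℝ, 1 ≤ CK ∧ ∃ cK > (0:ℝ), ∃ ν₀ > (0:ℝ),
      HighLabelDecayW cubatureWord M hM lo hi Λ β ν₀ Kb CK cK := by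
  intro M hM lo hi Λ β hlo hlo1 hhi hΛ hβ Kb hKb
  obtain ⟨R₁, hR₁, CK₂, hCK₂, cK₂, hcK₂, ν₂, hν₂, h₂⟩ := stub_largeR M hM lo hi Λ β hlo hlo1 hhi hΛ hβ Kb hKb
  obtain ⟨CK₁, hCK₁, cK₁, hcK₁, ν₁, hν₁, h₁⟩ := stub_compactRange M hM lo hi Λ β hlo hlo1 hhi hΛ hβ Kb hKb R₁ hR₁
  refine ⟨max CK₁ CK₂, le_max_of_le_left hCK₁, min cK₁ cK₂, lt_min hcK₁ hcK₂, min ν₁ ν₂, lt_min hν₁ hν₂, ?_⟩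
  exact stub_classReduction _ _ _ _ _ _ _ _ _ _ _ (classDecayW_split R₁ (zero_le_one.trans hCK₁) h₁ h₂)

end

end Summit.AnomalousDissipation.AnomalousDissipation.Cruxes.LagrangianRenormalisationStepDesign.HighLabelDecayRecut
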